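import Summits.KontsevichZagierPeriods.KontsevichZagierPeriods.Theorems.RootDecompZetaThreeFrontierRungFourPreludeP07

/-! # `RootDecompZetaThreeFrontierRungFourPreludeP08` — part 8/14 of the mechanical ≤400-line split of `pre_src.lean` (sha256 ba362a5194d75c20…)
Source: decomp-kz lens-1 g12/g13 rung-4 prelude = Prelude_v3.lean @ba362a51 (Basis22_v1 sections RotFour/Shuffle/ProdFour/GenFb/WordMoves/RungFour/Basis22 + FacetGeneric_v2 §1–§23; critic CLEARED g6 row 330 / g6-20 l.1368); --supports stmt-KontsevichZagierPeriods-27141.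
Split by census-1 g10 `gen/splitlean.py`: scopes re-opened with their `open`/`variable`/`set_option` context; mathematics and declaration order unchanged. -/

set_option linter.dupNamespace false

/-!
# (F_k) GENERIC FACET THEOREM — minimal self-contained extraction (gen 12, lens-1, FacetGeneric_v1)

For EVERY `k = M+1`: an integrable `ℚ`-combination of FRAME monomials `Σ_S q_S ∏_m 1/(S m).form` on the open
simplex `Δ_{M+1}` has identically vanishing residue along EVERY facet of the closed cell `X̄_δ ⊆ M̄_{0,k+3}`:
the `k` tail facets `{t_j,…,t_M,0}` (chart `T_j`), their `k` reflections `{1,t_0,…}` (reflection `t ↦ 1 − t∘rev`),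
and every inner run `{t_a,…,t_b}`, `a < b` (chart `R_{a,b} = ψ ∘ σ`; the gap facets are the runs `b = a+1`) —
`facets_all`, and the glue `facets_of_rep` from a `KZ.IntegralRep` with logarithmic integrand (`IsLogOn`).
This file is Facet4_v7 with every k = 4-specific section removed (§3 demo, §5–§6, §8–§13, §15–§16, the k = 4 cluster
bounds of §14): what is left is dimension-free.  Sections keep their Facet4_v7 numbers.

* §1–§2 (namespace `…GZLadder.FacetFour`): Fubini pole template `not_integrableOn_of_insertNth_lower` and the residue
  form `not_integrableOn_of_residue` (slot `i`, measurable domain `B`, compact positive-volume base set `K`,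
  `F (insertNth i t x) * t = G (x,t)` with `G` continuous on `K × [0,η₀]` and `G (x,0) ≠ 0` on `K` ⟹ `F ∉ L¹(B)`).
* §4 prelude: verbatim copies of the Rung4_v2 definitions `xpt`, `Chord`, `Chord.form` (delete at landing), plus
  `continuous_xpt`, `continuous_form`, `continuous_insertNth_pair'`.
* §7 the reflection (`Chord.refl`, `reflPt`, `form_refl`, `integrableOn_reflPt_iff`).
* §14 frame combinatorics (`Chord.vec`, `IsFrame`, `IsFrame.injective`, `IsFrame.card_filter_le`, `reflFam`,
  `isFrame_reflFam`, `sum_reflFam`).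
* §17 tail-scaling chart `T_j` (`integrableOn_pullT_iff`, Jacobian `p_j ^ tailCard j`).
* §18 tail facets: `resT`, `resT_eq_zero`, `IsFrame.nT_le`, `facet_tail`, `facet_tail_refl`.
* §19 run chart `R_{a,b} = ψ ∘ σ` (`integrableOn_pullR_iff`, Jacobian `p_b ^ runInt a b`).
* §20 run facets: `resR`, `resR_eq_zero`, `IsFrame.nR_le`, `facet_run`, `facets_all`.
* §21 glue: `IsLogOn` (prelude copy), `facets_of_rep`.
-/

open MeasureTheory Set
open Literature.NumberTheory.Transcendental

set_option linter.dupNamespace false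

namespace Summit.KontsevichZagierPeriods.KontsevichZagierPeriods.Cruxes.GZNormalFormWThree.GZLadder.FacetFour

open Summit.KontsevichZagierPeriods.KontsevichZagierPeriods.Theorems.RootDecompZetaThreeFrontierWordMoves

/-! ## §1 Fubini pole template in slot `i` -/

/-- `t ↦ i.insertNth t x` is continuous. [folklore] -/
private theorem continuous_insertNth {N : ℕ} (i : Fin (N + 1)) (x : Fin N → ℝ) :
    Continuous fun t : ℝ => (i.insertNth t x : Fin (N + 1) → ℝ) := by
  refine continuous_pi fun j => ?_
  refine Fin.succAboveCases i ?_ (fun k => ?_) j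
  · simpa using continuous_id'
  · simpa using continuous_const

/-- Fubini: the slot-`i` sections of an integrable function are a.e. integrable. [folklore] -/
private theorem ae_integrableOn_insertNth {N : ℕ} (i : Fin (N + 1)) {B : Set (Fin (N + 1) → ℝ)}
    (hB : MeasurableSet B) {f : (Fin (N + 1) → ℝ) → ℝ} (hf : IntegrableOn f B) :
    ∀ᵐ x : Fin N → ℝ, IntegrableOn (fun t : ℝ => f (i.insertNth t x))
      {t | (i.insertNth t x : Fin (N + 1) → ℝ) ∈ B} := by
  set e : (Fin (N + 1) → ℝ) ≃ᵐ ℝ × (Fin N → ℝ) := MeasurableEquiv.piFinSuccAbove (fun _ => ℝ) i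
  have he : MeasurePreserving e volume ((volume : Measure ℝ).prod (volume : Measure (Fin N → ℝ))) := by
    have h := volume_preserving_piFinSuccAbove (fun _ : Fin (N + 1) => ℝ) i
    rw [Measure.volume_eq_prod] at h
    exact h
  have he_symm : ∀ q, e.symm q = i.insertNth q.1 q.2 := fun q => by
    simp [e, MeasurableEquiv.piFinSuccAbove_symm_apply, Fin.insertNthEquiv]
  have h1 : Integrable (B.indicator f) volume := (integrable_indicator_iff hB).2 hf
  have h2 : Integrable (B.indicator f ∘ e.symm) ((volume : Measure ℝ).prod (volume : Measure (Fin N → ℝ))) :=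
    ((he.symm e).integrable_comp_emb e.symm.measurableEmbedding).2 h1
  refine (h2.prod_left_ae).mono fun x hx => ?_
  have hm : MeasurableSet {t : ℝ | (i.insertNth t x : Fin (N + 1) → ℝ) ∈ B} :=
    (continuous_insertNth i x).measurable hB
  refine (integrable_indicator_iff hm).1 (hx.congr (Filter.Eventually.of_forall fun t => ?_))
  show (B.indicator f ∘ e.symm) (t, x) = _
  rw [Function.comp_apply, he_symm]
  exact (Set.indicator_comp_right (fun t : ℝ => (i.insertNth t x : Fin (N + 1) → ℝ)) (g := f)).symm

/-- SLOT-`i` POLE TEMPLATE (lower-bound form).  If on a set `S` of base points of positive volume the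
fibre functions satisfy `m x ≤ |F (i.insertNth t x)| * t` for `t ∈ (0, η x) ⊆` the section of `B`,
with `0 < m x` and `0 < η x ≤ 1`, then `F` is not integrable on `B`. -/
theorem not_integrableOn_of_insertNth_lower {N : ℕ} (i : Fin (N + 1)) {B : Set (Fin (N + 1) → ℝ)}
    (hB : MeasurableSet B) (F : (Fin (N + 1) → ℝ) → ℝ) (S : Set (Fin N → ℝ)) (hvol : volume S ≠ 0)
    (η m : (Fin N → ℝ) → ℝ) (hη : ∀ x ∈ S, 0 < η x ∧ η x ≤ 1)
    (hsec : ∀ x ∈ S, Ioo 0 (η x) ⊆ {t | (i.insertNth t x : Fin (N + 1) → ℝ) ∈ B})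
    (hm : ∀ x ∈ S, 0 < m x) (hF : ∀ x ∈ S, ∀ t ∈ Ioo 0 (η x), m x ≤ |F (i.insertNth t x)| * t) :
    ¬ IntegrableOn F B := by
  intro hFi
  have hae := ae_integrableOn_insertNth i hB hFi
  refine false_of_ae_of_forall_not hae (S := S) (fun x hx h => ?_) hvol
  have h' : IntegrableOn (fun t => (F (i.insertNth t x) * t) / t ^ 1) (Ioo 0 (η x)) :=
    (h.mono_set (hsec x hx)).congr_fun
      (fun t ht => by rw [pow_one, mul_div_cancel_right₀ _ ht.1.ne']) measurableSet_Ioo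
  exact not_integrableOn_pole (M := fun t => F (i.insertNth t x) * t) (hm x hx) (hη x hx).1 (hη x hx).2
    le_rfl (fun y hy => by simpa [abs_mul, abs_of_pos hy.1] using hF x hx y hy) h'

/-! ## §2 Residue form (uniform lower bound from continuity on a compact set) -/

/-- RESIDUE TEMPLATE.  `F (i.insertNth t x) * t = G (x, t)` on `K × (0, η₀)`, `G` continuous on the compact
`K ×ˢ [0, η₀]`, `volume K ≠ 0`, `(0, η₀) ⊆` every section, and the "residue" `G (x, 0)` nowhere zero on `K`
⟹ `F` is not integrable on `B`. -/
theorem not_integrableOn_of_residue {N : ℕ} (i : Fin (N + 1)) {B : Set (Fin (N + 1) → ℝ)}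
    (hB : MeasurableSet B) (F : (Fin (N + 1) → ℝ) → ℝ) (K : Set (Fin N → ℝ)) (hK : IsCompact K)
    (hvol : volume K ≠ 0) {η₀ : ℝ} (hη₀ : 0 < η₀) (hη₁ : η₀ ≤ 1)
    (hsec : ∀ x ∈ K, Ioo 0 η₀ ⊆ {t | (i.insertNth t x : Fin (N + 1) → ℝ) ∈ B})
    (G : (Fin N → ℝ) × ℝ → ℝ) (hG : ContinuousOn G (K ×ˢ Icc 0 η₀))
    (hFG : ∀ x ∈ K, ∀ t ∈ Ioo 0 η₀, F (i.insertNth t x) * t = G (x, t))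
    (hR : ∀ x ∈ K, G (x, 0) ≠ 0) : ¬ IntegrableOn F B := by
  have hne : K.Nonempty := nonempty_of_measure_ne_zero hvol
  -- the residue `x ↦ |G (x, 0)|` is continuous and positive on the compact `K`: minimum `m₀ > 0`
  have hG0 : ContinuousOn (fun x => |G (x, 0)|) K := by
    refine (continuous_abs.comp_continuousOn (hG.comp (Continuous.continuousOn (by fun_prop)) ?_))
    intro x hx
    exact ⟨hx, ⟨le_rfl, hη₀.le⟩⟩
  obtain ⟨x₀, hx₀, hmin⟩ := hK.exists_isMinOn hne hG0
  set m₀ := |G (x₀, 0)| with hm₀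
  have hm₀pos : 0 < m₀ := abs_pos.2 (hR x₀ hx₀)
  have hmin' : ∀ x ∈ K, m₀ ≤ |G (x, 0)| := fun x hx => hmin hx
  -- uniform continuity of `G` on the compact product
  have hKc : IsCompact (K ×ˢ Icc (0:ℝ) η₀) := hK.prod isCompact_Icc
  have huc := hKc.uniformContinuousOn_of_continuous hG
  rw [Metric.uniformContinuousOn_iff] at huc
  obtain ⟨δ, hδ, hδG⟩ := huc (m₀ / 2) (by positivity)
  -- apply §1 with `η := min η₀ (δ/2)`, `m := m₀ / 2`
  refine not_integrableOn_of_insertNth_lower i hB F K hvol (fun _ => min η₀ (δ / 2)) (fun _ => m₀ / 2)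
    (fun x _ => ⟨lt_min hη₀ (by positivity), (min_le_left _ _).trans hη₁⟩)
    (fun x hx => (Ioo_subset_Ioo_right (min_le_left _ _)).trans (hsec x hx))
    (fun x _ => by positivity) (fun x hx t ht => ?_)
  have ht0 : 0 < t := ht.1
  have htη : t < η₀ := lt_of_lt_of_le ht.2 (min_le_left _ _)
  have htδ : t < δ / 2 := lt_of_lt_of_le ht.2 (min_le_right _ _)
  have hxt : (x, t) ∈ K ×ˢ Icc (0:ℝ) η₀ := ⟨hx, ⟨ht0.le, htη.le⟩⟩
  have hx0 : (x, (0:ℝ)) ∈ K ×ˢ Icc (0:ℝ) η₀ := ⟨hx, ⟨le_rfl, hη₀.le⟩⟩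
  have hdist : dist (x, t) (x, (0:ℝ)) < δ := by
    rw [Prod.dist_eq, dist_self, Real.dist_eq, sub_zero, abs_of_pos ht0]
    exact max_lt_iff.2 ⟨hδ, by linarith⟩
  have hclose : dist (G (x, t)) (G (x, 0)) < m₀ / 2 := hδG _ hxt _ hx0 hdist
  rw [Real.dist_eq] at hclose
  have hEq : |F (i.insertNth t x)| * t = |G (x, t)| := by
    rw [← hFG x hx t ⟨ht0, htη⟩, abs_mul, abs_of_pos ht0]
  rw [hEq]
  have := hmin' x hx
  have h3 : |G (x, 0)| ≤ |G (x, t)| + |G (x, t) - G (x, 0)| := by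
    calc |G (x, 0)| = |G (x, t) - (G (x, t) - G (x, 0))| := by ring_nf
      _ ≤ |G (x, t)| + |G (x, t) - G (x, 0)| := abs_sub _ _
  linarith

end Summit.KontsevichZagierPeriods.KontsevichZagierPeriods.Cruxes.GZNormalFormWThree.GZLadder.FacetFour

/-! ## §4 PRELUDE — verbatim copies of the Rung4_v2 §2 definitions `xpt`, `Chord`, `Chord.form`
(namespace `…GZLadder.RungFour`).  AT LANDING: delete this section and `import` the landed Rung4 part 1. -/

namespace Summit.KontsevichZagierPeriods.KontsevichZagierPeriods.Cruxes.GZNormalFormWThree.GZLadder.RungFour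

open Summit.KontsevichZagierPeriods.KontsevichZagierPeriods.Cruxes.GZNormalFormWThree.GZLadder.FacetFour
  (not_integrableOn_of_residue)

/-! continuity of the labelled points / chord forms / `insertNth` pairs -/

/-- `xpt` is continuous in the point -/
theorem continuous_xpt (k : ℕ) (l : Fin (k + 2)) : Continuous fun p : Fin k → ℝ => xpt k p l := by
  unfold xpt
  split_ifs
  · exact continuous_const
  · exact continuous_apply _
  · exact continuous_const

/-- Auxiliary step `continuous_form` (§4): continuous form. [bookkeeping] -/
theorem continuous_form {k : ℕ} (c : Chord k) : Continuous fun p : Fin k → ℝ => c.form p :=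
  (continuous_xpt k c.i).sub (continuous_xpt k c.j)

/-- Auxiliary step `continuous_insertNth_pair'` (§4): continuous insert Nth pair'. [bookkeeping] -/
theorem continuous_insertNth_pair' {M : ℕ} (i0 : Fin (M + 1)) :
    Continuous fun z : (Fin M → ℝ) × ℝ => (Fin.insertNth i0 z.2 z.1 : Fin (M + 1) → ℝ) := by
  refine continuous_pi fun j => ?_
  refine Fin.succAboveCases i0 ?_ (fun k => ?_) j
  · simpa using continuous_snd
  · have h : Continuous fun z : (Fin M → ℝ) × ℝ => z.1 k := (continuous_apply k).comp continuous_fst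
    simpa using h

/-! ## §7 The REFLECTION `t ↦ (1 - t_{k-1}, …, 1 - t_0)` (generic `k`): it maps chord forms to chord
forms EXACTLY (`form_reflPt`, no Jacobian factors), preserves `Δ_k` and Lebesgue measure, so every facet
lemma transports for free to the reflected facet (`t_{k-1} → 0` ↔ `t_0 → 1`, `t_l = t_{l+1}` ↔
`t_{k-2-l} = t_{k-1-l}`, `{1,∞}` ↔ `{∞,0}`, …).  (The ROTATION of D₇ does NOT have this property — Möbius
factors — which is why (F₄) uses reflection + direct charts, NODE ADDENDUM 24.) -/

/-- the reflection of the simplex -/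
def reflPt (k : ℕ) (t : Fin k → ℝ) : Fin k → ℝ := fun i => 1 - t (Fin.rev i)

/-- Auxiliary step `reflPt_reflPt` (§7): refl Pt refl Pt. [bookkeeping] -/
theorem reflPt_reflPt (k : ℕ) (t : Fin k → ℝ) : reflPt k (reflPt k t) = t := by
  funext i; simp [reflPt, Fin.rev_rev]

/-- Auxiliary step `continuous_reflPt` (§7): continuous refl Pt. [bookkeeping] -/
theorem continuous_reflPt (k : ℕ) : Continuous (reflPt k) :=
  continuous_pi fun _ => continuous_const.sub (continuous_apply _)

/-- the reflected chord `(i, j) ↦ (k+1-j, k+1-i)` -/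
def Chord.refl {k : ℕ} (c : Chord k) : Chord k :=
  ⟨Fin.rev c.j, Fin.rev c.i, Fin.rev_lt_rev.2 c.lt, by
    have h1 := c.proper; have h2 := c.lt; have hi := c.i.isLt; have hj := c.j.isLt
    have h2' : (c.i : ℕ) < c.j := h2
    simp only [Fin.val_rev]
    omega⟩

/-- Auxiliary step `refl_refl` (§7): refl refl. [bookkeeping] -/
theorem Chord.refl_refl {k : ℕ} (c : Chord k) : c.refl.refl = c := by
  cases c; simp [Chord.refl, Fin.rev_rev]

/-- Auxiliary step `refl_injective` (§7): refl injective. [bookkeeping] -/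
theorem Chord.refl_injective {k : ℕ} : Function.Injective (Chord.refl : Chord k → Chord k) :=
  fun c d h => by rw [← Chord.refl_refl c, ← Chord.refl_refl d, h]

/-- Auxiliary step `xpt_reflPt` (§7): xpt refl Pt. [bookkeeping] -/
theorem xpt_reflPt {k : ℕ} (t : Fin k → ℝ) (l : Fin (k + 2)) :
    xpt k (reflPt k t) l = 1 - xpt k t (Fin.rev l) := by
  have hl := l.isLt
  have hr : ((Fin.rev l : Fin (k + 2)) : ℕ) = k + 1 - l := by rw [Fin.val_rev]; omega
  unfold xpt
  simp only [hr]
  by_cases h0 : (l : ℕ) = 0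
  · rw [dif_pos h0, dif_neg (show ¬ (k + 1 - (l : ℕ) = 0) by omega),
      dif_neg (show ¬ (k + 1 - (l : ℕ) ≤ k) by omega)]
    ring
  rw [dif_neg h0]
  by_cases hk : (l : ℕ) ≤ k
  · rw [dif_pos hk, dif_neg (show ¬ (k + 1 - (l : ℕ) = 0) by omega),
      dif_pos (show k + 1 - (l : ℕ) ≤ k by omega)]
    simp only [reflPt]
    congr 2
    ext
    simp only [Fin.val_rev]
    omega
  · rw [dif_neg hk, dif_pos (show k + 1 - (l : ℕ) = 0 by omega)]
    ring

/-- chord forms map to chord forms under the reflection, with NO extra factor -/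
theorem form_reflPt {k : ℕ} (c : Chord k) (t : Fin k → ℝ) : c.form (reflPt k t) = c.refl.form t := by
  simp only [Chord.form, Chord.refl, xpt_reflPt]
  ring

/-- Auxiliary step `prod_form_reflPt` (§7): prod form refl Pt. [bookkeeping] -/
theorem prod_form_reflPt {k : ℕ} (S : Fin k → Chord k) (t : Fin k → ℝ) :
    (∏ m, 1 / (S m).form (reflPt k t)) = ∏ m, 1 / (S m).refl.form t := by
  simp only [form_reflPt]

/-- Auxiliary step `reflPt_mem` (§7): refl Pt mem. [bookkeeping] -/
theorem reflPt_mem {k : ℕ} {t : Fin k → ℝ} (ht : t ∈ KZ.openOrderedSimplex k) :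
    reflPt k t ∈ KZ.openOrderedSimplex k := by
  obtain ⟨h0, h1, hsa⟩ := ht
  refine ⟨fun i => ?_, fun i => ?_, fun i j hij => ?_⟩
  · simp only [reflPt]; linarith [h1 (Fin.rev i)]
  · simp only [reflPt]; linarith [h0 (Fin.rev i)]
  · simp only [reflPt]
    have := hsa (Fin.rev_lt_rev.2 hij)
    linarith

/-- Auxiliary step `reflPt_preimage` (§7): refl Pt preimage. [bookkeeping] -/
theorem reflPt_preimage (k : ℕ) : reflPt k ⁻¹' KZ.openOrderedSimplex k = KZ.openOrderedSimplex k := by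
  ext t
  constructor
  · intro h
    have := reflPt_mem h
    rwa [reflPt_reflPt] at this
  · intro h; exact reflPt_mem h

/-- the reflection as a measurable equivalence (an involution) -/
def reflMEquiv (k : ℕ) : (Fin k → ℝ) ≃ᵐ (Fin k → ℝ) where
  toFun := reflPt k
  invFun := reflPt k
  left_inv := reflPt_reflPt k
  right_inv := reflPt_reflPt k
  measurable_toFun := (continuous_reflPt k).measurable
  measurable_invFun := (continuous_reflPt k).measurable

/-- the reflection preserves Lebesgue measure -/
theorem measurePreserving_reflPt (k : ℕ) : MeasurePreserving (reflPt k) volume volume := by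
  have h1 : MeasurePreserving (fun t : Fin k → ℝ => fun i => t (Fin.rev i)) volume volume := by
    have h := measurePreserving_arrowCongr' (fun _ : Fin k => (volume : Measure ℝ)) (fun _ => volume)
      Fin.revPerm (MeasurableEquiv.refl ℝ) (fun _ => MeasurePreserving.id _)
    exact h
  have h2 : MeasurePreserving (fun s : Fin k → ℝ => fun i => (1 : ℝ) - s i) volume volume :=
    volume_preserving_pi fun _ => Measure.measurePreserving_sub_left volume (1 : ℝ)
  exact h2.comp h1

/-- TRANSPORT: `f ∈ L¹(Δ_k) ↔ f ∘ refl ∈ L¹(Δ_k)` -/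
theorem integrableOn_reflPt_iff {k : ℕ} (f : (Fin k → ℝ) → ℝ) :
    IntegrableOn f (KZ.openOrderedSimplex k) ↔ IntegrableOn (f ∘ reflPt k) (KZ.openOrderedSimplex k) := by
  have h := (measurePreserving_reflPt k).integrableOn_comp_preimage (reflMEquiv k).measurableEmbedding
    (f := f) (s := KZ.openOrderedSimplex k)
  rw [reflPt_preimage] at h
  exact h.symm

/-! ## §14 FRAME COMBINATORICS (generic `k`): the gap vectors (PRELUDE copies of Rung4_v2 `Chord.vec`,
`IsFrame`), injectivity of frames, the CLUSTER BOUND `#{m | S m supported in T} ≤ |T|` (ℚ-linear algebra),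
and stability of frames under the reflection.  These discharge the side hypotheses `hinj` / `hclus` of
§5–§12 for frames. -/

/-- Auxiliary step `linearIndependent_vec` (§14): linear Independent vec. [bookkeeping] -/
theorem IsFrame.linearIndependent_vec {k : ℕ} {S : Fin k → Chord k} (hS : IsFrame S) :
    LinearIndependent ℚ fun m => (S m).vec := by
  have h := hS.comp Fin.succ (Fin.succ_injective _)
  have e : (Fin.cons (fun _ : Fin (k + 1) => (1 : ℚ)) (fun m => (S m).vec) : Fin (k + 1) → Fin (k + 1) → ℚ) ∘
      Fin.succ = fun m => (S m).vec := by
    funext m; simp [Fin.cons_succ]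
  rwa [e] at h

/-- Auxiliary step `injective` (§14): injective. [bookkeeping] -/
theorem IsFrame.injective {k : ℕ} {S : Fin k → Chord k} (hS : IsFrame S) : Function.Injective S := by
  intro m m' h
  have hinj := hS.linearIndependent_vec.injective
  exact hinj (by simp only [h])

/-- CLUSTER BOUND: in a frame, at most `|T|` chords have gap vectors supported in `T`. -/
theorem IsFrame.card_filter_le {k : ℕ} {S : Fin k → Chord k} (hS : IsFrame S) (P : Chord k → Prop)
    [DecidablePred P] (T : Finset (Fin (k + 1))) (hP : ∀ c, P c → ∀ l, l ∉ T → c.vec l = 0) :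
    (Finset.univ.filter fun m => P (S m)).card ≤ T.card := by
  classical
  have hv : LinearIndependent ℚ (fun m : {m : Fin k // P (S m)} => (S m.1).vec) := by
    have h0 := hS.linearIndependent_vec.comp (fun m : {m : Fin k // P (S m)} => m.1) Subtype.val_injective
    rw [Function.comp_def] at h0
    exact h0
  let π : (Fin (k + 1) → ℚ) →ₗ[ℚ] (T → ℚ) := LinearMap.funLeft ℚ ℚ (Subtype.val : T → Fin (k + 1))
  have hdisj : Disjoint (Submodule.span ℚ (Set.range fun m : {m : Fin k // P (S m)} => (S m.1).vec))
      (LinearMap.ker π) := by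
    rw [Submodule.disjoint_def]
    intro v hv1 hv2
    have hsupp : ∀ l, l ∉ T → v l = 0 := by
      refine Submodule.span_induction (p := fun v _ => ∀ l, l ∉ T → v l = 0) ?_ ?_ ?_ ?_ hv1
      · rintro _ ⟨m, rfl⟩ l hl; exact hP _ m.2 l hl
      · intro l _; rfl
      · intro x y _ _ hx hy l hl; simp [hx l hl, hy l hl]
      · intro a x _ hx l hl; simp [hx l hl]
    have hker : ∀ l ∈ T, v l = 0 := fun l hl => by
      have h0 := LinearMap.mem_ker.1 hv2
      have := congrFun h0 ⟨l, hl⟩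
      simpa [π, LinearMap.funLeft_apply] using this
    funext l
    by_cases hl : l ∈ T
    · exact hker l hl
    · exact hsupp l hl
  have hv' := hv.map hdisj
  have hle := hv'.fintype_card_le_finrank
  rw [Module.finrank_fintype_fun_eq_card, Fintype.card_coe, Fintype.card_subtype] at hle
  exact hle

/-- k = 4 instances: the cluster counts of §6, §10, §11, §12 for frames -/
def reflFam {k : ℕ} (S : Fin k → Chord k) : Fin k → Chord k := fun m => (S m).refl

/-- Auxiliary step `reflFam_reflFam` (§14): refl Fam refl Fam. [bookkeeping] -/
theorem reflFam_reflFam {k : ℕ} (S : Fin k → Chord k) : reflFam (reflFam S) = S := by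
  funext m; simp [reflFam, Chord.refl_refl]

/-- Auxiliary step `reflFam_injective` (§14): refl Fam injective. [bookkeeping] -/
theorem reflFam_injective {k : ℕ} : Function.Injective (reflFam : (Fin k → Chord k) → (Fin k → Chord k)) :=
  fun S T h => by rw [← reflFam_reflFam S, ← reflFam_reflFam T, h]

end Summit.KontsevichZagierPeriods.KontsevichZagierPeriods.Cruxes.GZNormalFormWThree.GZLadder.RungFour
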